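import Literature.NumberTheory.BeurlingPrimes.WellBehavedSystemsRandom
import HarnessLib

/-!
# Broucke–Vindas 2024, Theorem 1.2 — IV. Assembly: `BrouckeVindas2024_thm12_holds`

Topic `Literature/NumberTheory/BeurlingPrimes`, grouping namespace `BrouckeVindas` (Broucke–Vindas 2024, §2).
Everything here is PROVED and definition-free; the file discharges the named fact `BrouckeVindas2024_thm12` of
`WellBehavedSystems.lean` (BV 2024, Theorem 1.2 = BDR 2023, Theorem 1.2, the random prime approximation).

The printed proof (BV §2) and the formal one side by side:
* BV split `dF = dF_c + dF_d` and draw `P_j` on `(q_{j−1}, q_j]` from `dF_c` (resp. a modified law for the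
  atoms); here one quantile coupling `p_j = G(j + ω_j)` (`G` a generalized inverse of `F`, part I;
  `ω ∈ (0,1]^ℕ` from i.i.d. uniform coordinates) handles every admissible `F` at once and gives
  `|π_𝒫(x) − F(x)| ≤ 1` (part II, `abs_primeCount_sub_le_one`), hence the printed `≤ 2`, and strictly increasing
  primes with `≤ 1` when `F` is continuous.
* BV bound `P(|S(q_J,t) − S_c(q_J,t)| ≥ √2 D(√x + …))` by Kolmogorov's exponential inequality (Lemma 2.1) and use
  Borel–Cantelli over integer `t = k` and levels `q_j`; here Hoeffding's inequality and a union bound over the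
  net `(G(n), k/⌈G(n)⌉)` with total mass `≤ 1/2` (part III, `exists_good`).
* BV pass from `q_{j−1} < x ≤ q_j` to `q_{j−1}` at cost `O(1)` and from integer `k` to `t ∈ [k, k+1]` by
  partial summation; here the mass level `⌊F(x)⌋` costs `2` (`norm_primeSum_sub_sub_dev_le`) and the net point
  `k/⌈G(n)⌉ ≤ t` costs `2C₁` (`norm_dev_sub_net_le`, from `|a^{−it} − a^{−it'}| ≤ |t−t'| log a`); negative `t`
  by conjugation as in BV. The Chebyshev hypothesis `F(x) ≤ Cx/log x` (`x ≥ 2`) is first normalised to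
  `F(x) ≤ C₁x/log(x+1)` (`x ≥ 1`, `C₁ ≥ 1`), BV's "Let `C` be a constant such that `F_c(x) ≤ Cx/log(x+1)`".
The final constant is `2 + 2C₁ + 2D₀√C₁`.

## References
* [BrouckeVindas2024] F. Broucke, J. Vindas, *A new generalized prime random approximation procedure and some of
  its applications*, Math. Z. 307 (2024), arXiv:2102.08478, §1 Theorem 1.2 and §2 (its proof) (read).
* [BrouckeDebruyneRevesz2023] F. Broucke, G. Debruyne, Sz. Gy. Révész, *Some examples of well-behaved Beurling
  number systems*, arXiv:2309.01567, Theorem 1.2 (= BV Theorem 1.2, quoted).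
-/

noncomputable section

open Complex Filter MeasureTheory Set
open scoped Topology

namespace Literature.NumberTheory.BeurlingPrimes

open Literature.Barriers.RiemannHypothesis

namespace BrouckeVindas

variable {F : StieltjesFunction ℝ}

/-! ### Normalising the Chebyshev bound -/

/-- `log(x+1) ≤ x` for `x ≥ 0`, so `1 ≤ x/log(x+1)` for `x ≥ 1`. [folklore] -/
theorem one_le_div_log {x : ℝ} (hx : 1 ≤ x) : 1 ≤ x / Real.log (x + 1) := by
  have hl : 0 < Real.log (x + 1) := Real.log_pos (by linarith)
  rw [le_div_iff₀ hl, one_mul]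
  linarith [Real.log_le_sub_one_of_pos (show 0 < x + 1 by linarith)]

/-- `log(x+1) ≤ 2 log x` for `x ≥ 2`. [folklore] -/
theorem log_add_one_le {x : ℝ} (hx : 2 ≤ x) : Real.log (x + 1) ≤ 2 * Real.log x := by
  rw [← Real.log_rpow (by linarith), show (2 : ℝ) = (2 : ℕ) by norm_num, Real.rpow_natCast]
  exact Real.log_le_log (by linarith) (by nlinarith)

/-- **Chebyshev normalisation** (BV: "Let `C` be a constant such that `F_c(x) ≤ C x/log(x+1)`"): from
`F(x) ≤ Cx/log x` (`x ≥ 2`) to `F(x) ≤ C₁x/log(x+1)` for all `x ≥ 1`, with `C₁ ≥ 1`.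
[cite: BrouckeVindas2024, §2 (proof of Theorem 1.2)] -/
theorem cheb_normalise {C : ℝ} (hC : ∀ x : ℝ, 2 ≤ x → F x ≤ C * x / Real.log x) :
    ∃ C₁ : ℝ, 1 ≤ C₁ ∧ ∀ x : ℝ, 1 ≤ x → F x ≤ C₁ * x / Real.log (x + 1) := by
  set C' := max C 0 with hC'
  have hC'0 : 0 ≤ C' := le_max_right _ _
  refine ⟨max 1 (8 * C'), le_max_left _ _, fun x hx ↦ ?_⟩
  have hlow : max 1 (8 * C') ≤ max 1 (8 * C') * x / Real.log (x + 1) := by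
    rw [mul_div_assoc]
    exact le_mul_of_one_le_right (by positivity) (one_le_div_log hx)
  have hl2 : (1 : ℝ) / 2 < Real.log 2 := by
    have := Real.log_two_gt_d9; linarith
  have hF2 : F 2 ≤ 4 * C' := by
    have h := hC 2 le_rfl
    have h' : C * 2 / Real.log 2 ≤ C' * 2 / Real.log 2 :=
      div_le_div_of_nonneg_right (by linarith [le_max_left C 0]) (by linarith)
    have h'' : C' * 2 / Real.log 2 ≤ C' * 2 / (1 / 2) :=
      div_le_div_of_nonneg_left (by positivity) (by norm_num) hl2.le
    linarith
  rcases le_or_gt x 2 with hx2 | hx2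
  · have h3 : F x ≤ F 2 := F.mono hx2
    linarith [le_max_right 1 (8 * C')]
  · have hlx : 0 < Real.log x := Real.log_pos (by linarith)
    have hlx1 : 0 < Real.log (x + 1) := Real.log_pos (by linarith)
    have h4 : F x ≤ C' * x / Real.log x :=
      (hC x hx2.le).trans (div_le_div_of_nonneg_right (by nlinarith [le_max_left C 0]) hlx.le)
    have h5 : C' * x / Real.log x ≤ 2 * C' * x / Real.log (x + 1) := by
      rw [div_le_div_iff₀ hlx hlx1]
      have := log_add_one_le hx2.le
      have : 0 ≤ C' * x := by positivity
      nlinarith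
    have h6 : 2 * C' * x / Real.log (x + 1) ≤ max 1 (8 * C') * x / Real.log (x + 1) :=
      div_le_div_of_nonneg_right (by nlinarith [le_max_right 1 (8 * C')]) hlx1.le
    linarith

/-! ### From the net to all `(x, t)` -/

section Net

variable {G : ℝ → ℝ} {D : (ℕ → ℝ) → ℕ → ℝ → ℂ} {ω : ℕ → ℝ} {P : BeurlingPrimes}
variable (hG : ∀ ⦃s : ℝ⦄, 0 < s → ∀ y : ℝ, G s ≤ y ↔ s ≤ F y) (hGm : Monotone G) (hG1 : ∀ s, 1 ≤ G s)
variable (hD : ∀ (ω : ℕ → ℝ) (n : ℕ) (t : ℝ), D ω n t =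
  ∑ j ∈ Finset.range n, ((G (j + ω j) : ℂ)) ^ (-(t * I)) - ∫ s in Ioc (0 : ℝ) n, ((G s : ℂ)) ^ (-(t * I)))
variable (hω : ∀ j, ω j ∈ Ioc (0 : ℝ) 1) (hP : ∀ j, P.prime j = G (j + ω j))

include hG hGm hG1 hD hω in
/-- **Reduction to the net point below `t`** (replaces BV's partial summation in `t`): for `n ≥ 1`, `t ≥ 0`,
`x_n = G(n)`, `N = ⌈x_n⌉`, `k = ⌊tN⌋`, `‖D(ω,n,t) − D(ω,n,k/N)‖ ≤ 2C₁` (as `n log x_n ≤ C₁ x_n`).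
[cite: BrouckeVindas2024, §2 (proof of Theorem 1.2)] -/
theorem norm_dev_sub_net_le {C₁ : ℝ} (hcheb : ∀ x, 1 ≤ x → F x ≤ C₁ * x / Real.log (x + 1))
    {n : ℕ} (hn : 1 ≤ n) {t : ℝ} (ht : 0 ≤ t) :
    ‖D ω n t - D ω n (⌊t * ⌈G n⌉₊⌋₊ / ⌈G n⌉₊)‖ ≤ 2 * C₁ := by
  set x := G n with hx
  set N := ⌈x⌉₊ with hN
  set k := ⌊t * N⌋₊ with hk
  have hx1 : 1 ≤ x := hG1 n
  have hx0 : 0 < x := by linarith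
  have hN0 : (0 : ℝ) < N := by exact_mod_cast Nat.ceil_pos.2 hx0
  have hxN : x ≤ N := Nat.le_ceil x
  have hn0 : (0 : ℝ) < n := by exact_mod_cast hn
  have hlog0 : 0 ≤ Real.log x := Real.log_nonneg hx1
  have habs : |t - k / N| ≤ 1 / N := by
    have hk1 : (k : ℝ) ≤ t * N := Nat.floor_le (by positivity)
    have hk2 : t * N < k + 1 := Nat.lt_floor_add_one _
    rw [abs_of_nonneg (by rw [sub_nonneg, div_le_iff₀ hN0]; exact hk1), sub_le_iff_le_add,
      ← add_div, le_div_iff₀ hN0]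
    linarith
  have hnx : (n : ℝ) * Real.log x ≤ C₁ * x := by
    have h := level_cheb hG hG1 hcheb hn
    rw [← hx, le_div_iff₀ (Real.log_pos (by linarith))] at h
    have : (n : ℝ) * Real.log x ≤ n * Real.log (x + 1) :=
      mul_le_mul_of_nonneg_left (Real.log_le_log hx0 (by linarith)) hn0.le
    linarith
  refine (norm_dev_sub_dev_le hGm hω hD hG1 n t _).trans ?_
  rw [← hx]
  calc 2 * n * (|t - k / N| * Real.log x) ≤ 2 * n * (1 / N * Real.log x) := by gcongr
    _ ≤ 2 * n * (1 / x * Real.log x) := by gcongr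
    _ = 2 * (n * Real.log x) / x := by field_simp
    _ ≤ 2 * (C₁ * x) / x := by gcongr
    _ = 2 * C₁ := by field_simp

include hG in
/-- **Comparing the threshold at the net point with the gauge at `(y, t)`**: for `1 ≤ n ≤ F(y)` (so
`x_n = G(n) ≤ y`) and a net point `t' ∈ [0, t]`,
`D₀(√x_n + √(n log(t'+1))) ≤ D₀√C₁(√y + √(y log(t+1)/log(y+1)))` (`n ≤ F(y) ≤ C₁ y/log(y+1)`).
[cite: BrouckeVindas2024, §2 (proof of Theorem 1.2)] -/
theorem threshold_le {C₁ : ℝ} (hC₁ : 1 ≤ C₁)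
    (hcheb : ∀ x, 1 ≤ x → F x ≤ C₁ * x / Real.log (x + 1)) {D₀ : ℝ} (hD₀ : 0 ≤ D₀)
    {n : ℕ} (hn : 1 ≤ n) {y : ℝ} (hy : 1 ≤ y) (hny : (n : ℝ) ≤ F y) {t t' : ℝ} (ht' : 0 ≤ t') (htt' : t' ≤ t) :
    D₀ * (Real.sqrt (G n) + Real.sqrt (n * Real.log (t' + 1))) ≤
      D₀ * Real.sqrt C₁ * (Real.sqrt y + Real.sqrt (y * Real.log (t + 1) / Real.log (y + 1))) := by
  have hn0 : (0 : ℝ) < n := by exact_mod_cast hn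
  have hxy : G n ≤ y := (hG hn0 y).2 hny
  have hC1 : 1 ≤ Real.sqrt C₁ := by rw [← Real.sqrt_one]; exact Real.sqrt_le_sqrt hC₁
  have hly : 0 < Real.log (y + 1) := Real.log_pos (by linarith)
  have hlt' : 0 ≤ Real.log (t' + 1) := Real.log_nonneg (by linarith)
  have h₁ : Real.sqrt (G n) ≤ Real.sqrt C₁ * Real.sqrt y :=
    (Real.sqrt_le_sqrt hxy).trans (le_mul_of_one_le_left (Real.sqrt_nonneg y) hC1)
  have h₂ : (n : ℝ) * Real.log (t' + 1) ≤ C₁ * (y * Real.log (t + 1) / Real.log (y + 1)) := by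
    have ha : (n : ℝ) ≤ C₁ * y / Real.log (y + 1) := hny.trans (hcheb y hy)
    have hb : Real.log (t' + 1) ≤ Real.log (t + 1) := Real.log_le_log (by linarith) (by linarith)
    calc (n : ℝ) * Real.log (t' + 1) ≤ C₁ * y / Real.log (y + 1) * Real.log (t + 1) :=
          mul_le_mul ha hb hlt' (by positivity)
      _ = C₁ * (y * Real.log (t + 1) / Real.log (y + 1)) := by field_simp
  have h₃ : Real.sqrt (n * Real.log (t' + 1)) ≤
      Real.sqrt C₁ * Real.sqrt (y * Real.log (t + 1) / Real.log (y + 1)) := by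
    rw [← Real.sqrt_mul (by linarith)]
    exact Real.sqrt_le_sqrt h₂
  calc D₀ * (Real.sqrt (G n) + Real.sqrt (n * Real.log (t' + 1)))
      ≤ D₀ * (Real.sqrt C₁ * Real.sqrt y +
          Real.sqrt C₁ * Real.sqrt (y * Real.log (t + 1) / Real.log (y + 1))) := by gcongr
    _ = D₀ * Real.sqrt C₁ * (Real.sqrt y + Real.sqrt (y * Real.log (t + 1) / Real.log (y + 1))) := by ring

include hG hGm hG1 hD hω hP in
/-- **The bound at a good sample point, `t ≥ 0`**: if `ω ∈ (0,1]^ℕ` is good at every net point (conclusion of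
`exists_good`) then for `y ≥ 1`, `t ≥ 0`,
`‖S_𝒫(y,t) − ∫_{[1,y]} u^{−it} dF(u)‖ ≤ (2 + 2C₁ + 2D₀√C₁)(√y + √(y log(t+1)/log(y+1)))`.
[cite: BrouckeVindas2024, §2 (proof of Theorem 1.2)] -/
theorem norm_sub_le_of_good (h0 : ∀ x, 0 ≤ F x) {C₁ : ℝ} (hC₁ : 1 ≤ C₁)
    (hcheb : ∀ x, 1 ≤ x → F x ≤ C₁ * x / Real.log (x + 1)) {D₀ : ℝ} (hD₀ : 0 ≤ D₀)
    (hgood : ∀ n : ℕ, 1 ≤ n → ∀ k : ℕ, ‖D ω n (k / ⌈G n⌉₊)‖ <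
      2 * (D₀ * (Real.sqrt (G n) + Real.sqrt (n * Real.log (k / ⌈G n⌉₊ + 1)))))
    {y t : ℝ} (hy : 1 ≤ y) (ht : 0 ≤ t) :
    ‖P.primeSum y t - stieltjesExpSum F y t‖ ≤
      (2 + 2 * C₁ + 2 * (D₀ * Real.sqrt C₁)) *
        (Real.sqrt y + Real.sqrt (y * Real.log (t + 1) / Real.log (y + 1))) := by
  set g := Real.sqrt y + Real.sqrt (y * Real.log (t + 1) / Real.log (y + 1)) with hg
  have hg1 : 1 ≤ g := by
    have h1y : 1 ≤ Real.sqrt y := by rw [← Real.sqrt_one]; exact Real.sqrt_le_sqrt hy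
    have : 0 ≤ Real.sqrt (y * Real.log (t + 1) / Real.log (y + 1)) := Real.sqrt_nonneg _
    linarith
  have hC0 : 0 ≤ C₁ := by linarith
  have hDC : 0 ≤ D₀ * Real.sqrt C₁ := by positivity
  set n := ⌊F y⌋₊ with hn
  have hlevel := norm_primeSum_sub_sub_dev_le hG hGm hω hP hD hG1 h0 y t
  rw [← hn] at hlevel
  rcases Nat.eq_zero_or_pos n with hn0 | hnpos
  · rw [hn0, dev_zero hD, sub_zero] at hlevel
    calc _ ≤ (2 : ℝ) := hlevel
      _ ≤ 2 * g := by nlinarith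
      _ ≤ (2 + 2 * C₁ + 2 * (D₀ * Real.sqrt C₁)) * g := by
          apply mul_le_mul_of_nonneg_right _ (by linarith); nlinarith
  · have hn1 : 1 ≤ n := hnpos
    set N := ⌈G n⌉₊ with hN
    set k := ⌊t * N⌋₊ with hk
    have hN0 : (0 : ℝ) < N := by
      exact_mod_cast Nat.ceil_pos.2 (one_pos.trans_le (hG1 (n : ℝ)))
    have ht'0 : (0 : ℝ) ≤ k / N := by positivity
    have ht't : (k : ℝ) / N ≤ t := by
      rw [div_le_iff₀ hN0]; exact Nat.floor_le (by positivity)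
    have hnet := norm_dev_sub_net_le hG hGm hG1 hD hω hcheb hn1 ht
    have hgk := hgood n hn1 k
    have hthr := threshold_le hG hC₁ hcheb hD₀ hn1 hy (Nat.floor_le (h0 y)) ht'0 ht't
    have htri : ‖P.primeSum y t - stieltjesExpSum F y t‖ ≤
        ‖P.primeSum y t - stieltjesExpSum F y t - D ω n t‖ +
          ‖D ω n t - D ω n (k / N)‖ + ‖D ω n (k / N)‖ := by
      calc ‖P.primeSum y t - stieltjesExpSum F y t‖
          = ‖(P.primeSum y t - stieltjesExpSum F y t - D ω n t) + (D ω n t - D ω n (k / N)) + D ω n (k / N)‖ := by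
            congr 1; ring
        _ ≤ _ := norm_add₃_le
    calc _ ≤ 2 + 2 * C₁ + 2 * (D₀ * Real.sqrt C₁ * g) := by
          refine htri.trans (add_le_add (add_le_add hlevel hnet) (hgk.le.trans ?_))
          exact mul_le_mul_of_nonneg_left hthr (by norm_num)
      _ ≤ (2 + 2 * C₁ + 2 * (D₀ * Real.sqrt C₁)) * g := by nlinarith

include hG hGm hG1 hD hω hP in
/-- **The bound at a good sample point, all real `t`** (negative `t` by conjugation, BV: "for negative `t` we
obtain the same bounds by taking the complex conjugate"). [cite: BrouckeVindas2024, §2 (proof of Theorem 1.2)] -/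
theorem norm_sub_le_of_good' (h0 : ∀ x, 0 ≤ F x) {C₁ : ℝ} (hC₁ : 1 ≤ C₁)
    (hcheb : ∀ x, 1 ≤ x → F x ≤ C₁ * x / Real.log (x + 1)) {D₀ : ℝ} (hD₀ : 0 ≤ D₀)
    (hgood : ∀ n : ℕ, 1 ≤ n → ∀ k : ℕ, ‖D ω n (k / ⌈G n⌉₊)‖ <
      2 * (D₀ * (Real.sqrt (G n) + Real.sqrt (n * Real.log (k / ⌈G n⌉₊ + 1)))))
    (t y : ℝ) (hy : 1 ≤ y) :
    ‖P.primeSum y t - stieltjesExpSum F y t‖ ≤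
      (2 + 2 * C₁ + 2 * (D₀ * Real.sqrt C₁)) *
        (Real.sqrt y + Real.sqrt (y * Real.log (|t| + 1) / Real.log (y + 1))) := by
  rcases le_or_gt 0 t with ht | ht
  · rw [abs_of_nonneg ht]
    exact norm_sub_le_of_good hG hGm hG1 hD hω hP h0 hC₁ hcheb hD₀ hgood hy ht
  · rw [abs_of_neg ht, ← norm_primeSum_sub_stieltjesExpSum_neg hG hGm hG1 h0]
    exact norm_sub_le_of_good hG hGm hG1 hD hω hP h0 hC₁ hcheb hD₀ hgood hy (by linarith)

end Net

/-- **The construction, packaged**: for an admissible `F` there are a Beurling system `P` (the quantile coupling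
`p_j = G(j + ω_j)` at a good sample point) with `|π_P(x) − F(x)| ≤ 1` for all `x`, strictly increasing primes if
`F` is continuous, and a constant `C'` with `‖S_P(x,t) − ∫_1^x u^{−it} dF(u)‖ ≤ C'(√x + √(x log(|t|+1)/log(x+1)))`
for all real `t` and `x ≥ 1`. [cite: BrouckeVindas2024, Theorem 1.2] -/
theorem exists_system (h1 : F 1 = 0) (h0 : ∀ x, 0 ≤ F x) (hF : Tendsto (fun x : ℝ ↦ F x) atTop atTop)
    {C : ℝ} (hC : ∀ x : ℝ, 2 ≤ x → F x ≤ C * x / Real.log x) :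
    ∃ P : BeurlingPrimes, (∀ x : ℝ, |(P.primeCount x : ℝ) - F x| ≤ 1) ∧
      ((Continuous fun x : ℝ ↦ F x) → StrictMono P.prime) ∧
      ∃ C' : ℝ, ∀ t x : ℝ, 1 ≤ x →
        ‖P.primeSum x t - stieltjesExpSum F x t‖ ≤
          C' * (Real.sqrt x + Real.sqrt (x * Real.log (|t| + 1) / Real.log (x + 1))) := by
  obtain ⟨G, hG, hGm, hG1⟩ := exists_galois h1 hF
  set D : (ℕ → ℝ) → ℕ → ℝ → ℂ := fun ω n t ↦
    ∑ j ∈ Finset.range n, ((G (j + ω j) : ℂ)) ^ (-(t * I)) - ∫ s in Ioc (0 : ℝ) n, ((G s : ℂ)) ^ (-(t * I))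
    with hDdef
  have hD : ∀ (ω : ℕ → ℝ) (n : ℕ) (t : ℝ), D ω n t =
      ∑ j ∈ Finset.range n, ((G (j + ω j) : ℂ)) ^ (-(t * I)) - ∫ s in Ioc (0 : ℝ) n, ((G s : ℂ)) ^ (-(t * I)) :=
    fun _ _ _ ↦ rfl
  obtain ⟨C₁, hC₁, hcheb⟩ := cheb_normalise hC
  obtain ⟨D₀, hD₀, ω, hω, hgood⟩ := exists_good h1 hG hGm hG1 hD hC₁ hcheb
  obtain ⟨P, hP⟩ := exists_beurlingPrimes h1 hG hGm hω
  exact ⟨P, abs_primeCount_sub_le_one hG hω hP h0, strictMono_prime hG hGm hω hP,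
    2 + 2 * C₁ + 2 * (D₀ * Real.sqrt C₁), fun t x hx ↦
      norm_sub_le_of_good' hG hGm hG1 hD hω hP h0 hC₁ hcheb hD₀ hgood t x hx⟩

end BrouckeVindas

/-- **Broucke–Vindas 2024, Theorem 1.2, PROVED** (discharges `BrouckeVindas2024_thm12`; = BDR 2023, Theorem 1.2).
"Let `F` be a non-decreasing right-continuous function tending to `∞`, with `F(1) = 0` and satisfying the
Chebyshev upper bound `F(x) ≪ x/log x`. Then there exists a set of generalized primes `𝒫 = {p_j}` such that
`|π_𝒫(x) − F(x)| ≤ 2` and such that for any `t` and any `x ≥ 1`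
`|Σ_{p_j ≤ x} p_j^{−it} − ∫_1^x u^{−it} dF(u)| ≪ √x + √(x log(|t|+1)/log(x+1))`. If in addition `F` is continuous,
the sequence `𝒫` can be chosen to be (strictly) increasing and such that `|π_𝒫(x) − F(x)| ≤ 1`." The system is
the quantile coupling `p_j = G(j + ω_j)` at a good sample point `ω ∈ (0,1]^ℕ` (parts I–III); it gives
`|π_𝒫 − F| ≤ 1` for every admissible `F`. [cite: BrouckeVindas2024, Theorem 1.2] -/
theorem BrouckeVindas2024_thm12_holds : BrouckeVindas2024_thm12 := by
  intro F h1 h0 hF hC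
  obtain ⟨C, hC⟩ := hC
  obtain ⟨P, hπ, hmono, C', hb⟩ := BrouckeVindas.exists_system h1 h0 hF hC
  exact ⟨⟨P, fun x ↦ (hπ x).trans one_le_two, C', hb⟩, fun hc ↦ ⟨P, hmono hc, hπ, C', hb⟩⟩

end Literature.NumberTheory.BeurlingPrimes
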